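import Summits.Ventures.Crystal3D.Theorems.StickyWulffConstantGenericWallFloorShellCount
import HarnessLib

/-!
# Rim lines are few: a family injecting into the balls of an annular slab of the cell has `O((b−a)·c·ρ)` members
# (crux `GenericWallFloor`, stmt-Ventures-19480, line `WallLedgerG`; lane T's F4 — the near-rim zigzag lines, cf-p1 §86(58) BA)

HONEST FRAMING. Venture `Summits/Ventures/Crystal3D` (cell `crystal3d-full`), helper `--supports` the crux `GenericWallFloor`
(stmt-Ventures-19480) of `route-Ventures-StickyWulffConstant`, registered line `WallLedgerG`, open stub `stub_twoSlabAdhesion`.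
Rung credit only; F-C1 not moved; NOT the stub.  Pure counting.

In F4 the zigzag lines whose lowest window vertex lies within `c = O(h + R₀)` of the lateral boundary carry no certified walker
(their predecessor dozens or their drift leave the cylinder); they are charged to the rim term `C(1+h)ρ` instead: distinct lines
have distinct lowest window vertices, which are `1`-separated balls of `X` in the annular slab
`{a ≤ p₂ ≤ b, (ρ−c)² < p₀² + p₁² ≤ ρ²}`, and `card_mul_le_of_separated_in_shell` (`…ShellCount`) counts those.

* **`card_le_of_injOn_annulus`** — if `f` maps the finite family `T` injectively to `1`-separated points of that slab (`1 ≤ ρ − c`,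
  `0 ≤ c`, `a ≤ b`), then `#T ≤ 12·(b − a + 2)·(c + 2)·ρ`.
WHAT THIS IS NOT: not F4; F-C1 not moved.
-/

noncomputable section

namespace Summit.Ventures.Crystal3D.Theorems

open Finset

/-- **Rim lines are few.**  See the module docstring. -/
theorem card_le_of_injOn_annulus {X : Finset (EuclideanSpace ℝ (Fin 3))}
    (hX : ∀ p ∈ X, ∀ q ∈ X, p ≠ q → 1 ≤ dist p q) (a b ρ c : ℝ) (hab : a ≤ b) (hc : 0 ≤ c) (hρc : 1 ≤ ρ - c)
    {ι : Type*} (T : Finset ι) (f : ι → EuclideanSpace ℝ (Fin 3))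
    (hinj : ∀ t ∈ T, ∀ t' ∈ T, f t = f t' → t = t') (hfX : ∀ t ∈ T, f t ∈ X)
    (hwin : ∀ t ∈ T, a ≤ f t 2 ∧ f t 2 ≤ b)
    (hann : ∀ t ∈ T, (ρ - c) ^ 2 < f t 0 ^ 2 + f t 1 ^ 2 ∧ f t 0 ^ 2 + f t 1 ^ 2 ≤ ρ ^ 2) :
    (T.card : ℝ) ≤ 12 * (b - a + 2) * (c + 2) * ρ := by
  classical
  set S : Finset (EuclideanSpace ℝ (Fin 3)) := T.image f with hS
  have hcard : S.card = T.card := Finset.card_image_of_injOn fun t ht t' ht' h => hinj t ht t' ht' h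
  have hSX : ∀ p ∈ S, p ∈ X := by
    intro p hp; obtain ⟨t, ht, rfl⟩ := Finset.mem_image.1 hp; exact hfX t ht
  have hSsep : ∀ p ∈ S, ∀ q ∈ S, p ≠ q → 1 ≤ dist p q := fun p hp q hq hpq => hX p (hSX p hp) q (hSX q hq) hpq
  have hmem : ∀ p ∈ S, a ≤ p 2 ∧ p 2 ≤ b ∧ (ρ - c) ^ 2 < p 0 ^ 2 + p 1 ^ 2 ∧ p 0 ^ 2 + p 1 ^ 2 ≤ ρ ^ 2 := by
    intro p hp
    obtain ⟨t, ht, rfl⟩ := Finset.mem_image.1 hp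
    exact ⟨(hwin t ht).1, (hwin t ht).2, (hann t ht).1, (hann t ht).2⟩
  have key := card_mul_le_of_separated_in_shell S hSsep a b (ρ - c) ρ hab hρc (by linarith) hmem
  rw [hcard] at key
  -- (ρ+1)² − (ρ−c−1)² = (c+2)(2ρ − c) ≤ 2(c+2)ρ
  have hρ0 : 0 ≤ ρ := by linarith
  have h1 : Real.pi * (ρ + 1) ^ 2 - Real.pi * (ρ - c - 1) ^ 2 ≤ Real.pi * (2 * (c + 2) * ρ) := by
    have e : Real.pi * (ρ + 1) ^ 2 - Real.pi * (ρ - c - 1) ^ 2 = Real.pi * ((c + 2) * (2 * ρ - c)) := by ring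
    rw [e]
    apply mul_le_mul_of_nonneg_left _ Real.pi_pos.le
    nlinarith
  have h2 : (b - a + 2) * (Real.pi * (ρ + 1) ^ 2 - Real.pi * (ρ - c - 1) ^ 2) ≤ (b - a + 2) * (Real.pi * (2 * (c + 2) * ρ)) :=
    mul_le_mul_of_nonneg_left h1 (by linarith)
  have h3 : (T.card : ℝ) * (Real.pi / 6) ≤ (b - a + 2) * (Real.pi * (2 * (c + 2) * ρ)) := key.trans h2
  have e2 : (b - a + 2) * (Real.pi * (2 * (c + 2) * ρ)) = (Real.pi / 6) * (12 * (b - a + 2) * (c + 2) * ρ) := by ring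
  rw [e2] at h3
  have hπ : 0 < Real.pi / 6 := by positivity
  nlinarith

end Summit.Ventures.Crystal3D.Theorems

end
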